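import Literature.AnabelianGeometry.EtaleTheta.ContH1
import Literature.AnabelianGeometry.EtaleTheta.ContH1Lemmas
import Mathlib.GroupTheory.OrderOfElement
import HarnessLib

/-!
# Continuous `H¹`: change of coefficients along an inclusion `A ≤ A'` (supplement to `ContH1.lean`)

Neukirch–Schmidt–Wingberg, *Cohomology of Number Fields*, I §2 / II §7 (functoriality of `H¹` in the
coefficient module) [cite: NeukirchSchmidtWingberg2008, I §2 and II §7]; used in [EtTh] §1–§2 for the passage
`H¹(−, l·Δ_Θ) → H¹(−, Δ_Θ)` between the cohomology with coefficients in the sub-cyclotome `l·Δ_Θ ⊆ Δ_Θ` and in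
`Δ_Θ` itself (Mochizuki, *The étale theta function …*, Def. 2.7 p. 41: "the class `η̈^Θ` determines a class
`η̲̈^Θ ∈ H¹(Π^tp_Ÿ̲̲, l·Δ_Θ)`"; [IUTchII] Prop. 1.4 / Cor. 1.12 compare classes in `H¹(Π_Ÿ(Π), (l·Δ_Θ)(Π))` with
`θ`-classes). [cite: MochizukiEtTh2009, Def 2.7 p.41]

This file SUPPLEMENTS abc-iut-L2-t1's `ContH1.lean` (landed, frozen; one FQN per notion — nothing there is
restated) with the functoriality of `ContH1 φ A H` in the COEFFICIENTS: for abelian normal subgroups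
`A ≤ A'` of `G'` (both with the conjugation action through `φ : G → G'`), the map
`H¹(H, A) → H¹(H, A')` induced by the inclusion (`ContH1.coeffChange`), on cocycles (`coeffCocycle`), its
value on classes (`coeffChange_mk`), functoriality (`coeffChange_refl`, `coeffChange_trans`) and its
compatibility with the three structure maps of `ContH1.lean`: restriction along `H₁ ≤ H₂` (`res_coeffChange`),
the conjugation action on a normal `H` (`conj_coeffChange`), and inflation along `ψ : G₀ → G'`
(`infl_coeffChange`), plus the pull-back `ContH1.comap` along a continuous `ι : G₀ → G` with `ι(H₀) ≤ H`
(functoriality in the GROUP, generalising `ContH1.infl` to a conjugation action through any `φ`; `comap_mk`,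
`res_comap`, `comap_conj`, `comap_coeffChange`); and the torsion bound on its kernel (`pow_eq_one_of_coeffChange_eq_one`: if every `a' ∈ A'`
has `a' ^ n ∈ A` then `coeffChange x = 1 → x ^ n = 1` — the `H⁰(H, A'/A) → H¹(H, A) → H¹(H, A')` piece used to move
torsion statements between `H¹(−, l·Δ_Θ)` and `H¹(−, Δ_Θ)`). Elementary; takes no side on anything (abc-iut cell, F14 cohomology spine input offered
to abc-iut-L6-t1's `CohomologySystemOfContH1` / `EtaleThetaDataOfSetting`).
-/

namespace Literature.AnabelianGeometry.EtaleTheta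

open scoped IsMulCommutative

section CoeffChange

variable {G G' : Type*} [Group G] [TopologicalSpace G]
  [Group G'] [TopologicalSpace G'] [IsTopologicalGroup G']
  (φ : G →* G') {A A' : Subgroup G'} [A.Normal] [IsMulCommutative A] [A'.Normal] [IsMulCommutative A']
  (hAA' : A ≤ A') (H : Subgroup G)

namespace ContH1

omit [TopologicalSpace G'] [IsTopologicalGroup G'] [IsMulCommutative A] [IsMulCommutative A'] in
/-- Conjugation commutes with the inclusion of normal subgroups `A ≤ A'` (both computed in `G'`).
[cite: NeukirchSchmidtWingberg2008, I §2 and II §7] -/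
theorem inclusion_conjNormal (g : G') (a : A) :
    Subgroup.inclusion hAA' (MulAut.conjNormal g a) = MulAut.conjNormal g (Subgroup.inclusion hAA' a) :=
  Subtype.ext (by simp [MulAut.conjNormal_apply])

/-- Change of coefficients on continuous cocycles: `f ↦ (A ↪ A') ∘ f`.
[cite: NeukirchSchmidtWingberg2008, I §2 and II §7] -/
def coeffCocycle : contCocycles φ A H →* contCocycles φ A' H where
  toFun f := ⟨fun x => Subgroup.inclusion hAA' (f.1 x),
    (continuous_inclusion hAA').comp f.2.1,
    fun g h => by
      dsimp only
      rw [f.2.2, map_mul, inclusion_conjNormal]⟩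
  map_one' := Subtype.ext (funext fun _ => by simp)
  map_mul' f g := Subtype.ext (funext fun _ => by simp)

/-- `coeffCocycle` on values. [cite: NeukirchSchmidtWingberg2008, I §2 and II §7] -/
@[simp] theorem coeffCocycle_apply (f : contCocycles φ A H) (x : H) :
    (coeffCocycle φ hAA' H f).1 x = Subgroup.inclusion hAA' (f.1 x) := rfl

/-- **Change of coefficients** `H¹(H, A) → H¹(H, A')` along the inclusion `A ≤ A'` of abelian normal
subgroups of `G'` (coboundaries go to coboundaries: `∂a ↦ ∂(a : A')`).
[cite: NeukirchSchmidtWingberg2008, I §2 and II §7] -/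
def coeffChange : ContH1 φ A H →* ContH1 φ A' H :=
  QuotientGroup.map _ _ (coeffCocycle φ hAA' H) (by
    intro f hf
    obtain ⟨a, ha⟩ := (mem_contCoboundaries_iff _).mp (Subgroup.mem_subgroupOf.mp hf)
    refine Subgroup.mem_subgroupOf.mpr ((mem_contCoboundaries_iff _).mpr ⟨Subgroup.inclusion hAA' a, ?_⟩)
    funext x
    have hx := congrFun ha x
    change Subgroup.inclusion hAA' (f.1 x) = _
    rw [hx, map_mul, map_inv, inclusion_conjNormal])

/-- `coeffChange` on the class of a cocycle. [cite: NeukirchSchmidtWingberg2008, I §2 and II §7] -/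
theorem coeffChange_mk (f : H → A) (hf : f ∈ contCocycles φ A H) :
    coeffChange φ hAA' H (ContH1.mk f hf) =
      ContH1.mk (fun x => Subgroup.inclusion hAA' (f x)) (coeffCocycle φ hAA' H ⟨f, hf⟩).2 := rfl

/-- Change of coefficients along `A ≤ A` is the identity. [cite: NeukirchSchmidtWingberg2008, I §2 and II §7] -/
theorem coeffChange_refl (x : ContH1 φ A H) : coeffChange φ (le_refl A) H x = x := by
  induction x using QuotientGroup.induction_on with
  | H f => rfl

variable {A'' : Subgroup G'} [A''.Normal] [IsMulCommutative A''] (hA'A'' : A' ≤ A'')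

/-- Change of coefficients is functorial: `A ≤ A' ≤ A''`. [cite: NeukirchSchmidtWingberg2008, I §2 and II §7] -/
theorem coeffChange_trans (x : ContH1 φ A H) :
    coeffChange φ hA'A'' H (coeffChange φ hAA' H x) = coeffChange φ (hAA'.trans hA'A'') H x := by
  induction x using QuotientGroup.induction_on with
  | H f => rfl

/-- Change of coefficients commutes with RESTRICTION along `H₁ ≤ H₂`.
[cite: NeukirchSchmidtWingberg2008, I §2 and II §7] -/
theorem res_coeffChange {H₁ H₂ : Subgroup G} (h : H₁ ≤ H₂) (x : ContH1 φ A H₂) :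
    ContH1.res φ A' h (coeffChange φ hAA' H₂ x) = coeffChange φ hAA' H₁ (ContH1.res φ A h x) := by
  induction x using QuotientGroup.induction_on with
  | H f => rfl

/-- Change of coefficients commutes with the CONJUGATION ACTION of `σ ∈ G` on a normal `H`.
[cite: NeukirchSchmidtWingberg2008, I §2 and II §7] -/
theorem conj_coeffChange [IsTopologicalGroup G] [H.Normal] (σ : G) (x : ContH1 φ A H) :
    ContH1.conj φ A' σ (coeffChange φ hAA' H x) = coeffChange φ hAA' H (ContH1.conj φ A σ x) := by
  induction x using QuotientGroup.induction_on with
  | H f =>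
    apply congrArg (QuotientGroup.mk (s := (contCoboundaries φ A' H).subgroupOf (contCocycles φ A' H)))
    apply Subtype.ext
    funext y
    change MulAut.conjNormal (φ σ) (Subgroup.inclusion hAA' (f.1 _)) =
      Subgroup.inclusion hAA' (MulAut.conjNormal (φ σ) (f.1 _))
    rw [inclusion_conjNormal]

/-- **The kernel of the change of coefficients is torsion** when `A'`-elements have `n`-th powers in `A`
(e.g. `A = l·A'`, `n = l`): if `coeffChange x = 1` then `x ^ n = 1`. (Proof: `(A ↪ A') ∘ f = ∂a'` with `a' ∈ A'`
forces `f ^ n = ∂(a' ^ n)` with `a' ^ n ∈ A`, since `a'` commutes with its conjugates inside the commutative `A'`.)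
This is the piece of the long exact sequence `H⁰(H, A'/A) → H¹(H, A) → H¹(H, A')` that consumers use to move
torsion statements between `H¹(−, l·Δ_Θ)` and `H¹(−, Δ_Θ)`. [cite: NeukirchSchmidtWingberg2008, I §2 and II §7] -/
theorem pow_eq_one_of_coeffChange_eq_one (n : ℕ) (hpow : ∀ a' : A', ((a' : G') ^ n) ∈ A)
    (x : ContH1 φ A H) (hx : coeffChange φ hAA' H x = 1) : x ^ n = 1 := by
  induction x using QuotientGroup.induction_on with
  | H f =>
    have hmem : coeffCocycle φ hAA' H f ∈ (contCoboundaries φ A' H).subgroupOf (contCocycles φ A' H) :=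
      (QuotientGroup.eq_one_iff _).mp hx
    obtain ⟨a', ha'⟩ := (mem_contCoboundaries_iff _).mp (Subgroup.mem_subgroupOf.mp hmem)
    change (QuotientGroup.mk (f ^ n) :
        contCocycles φ A H ⧸ (contCoboundaries φ A H).subgroupOf (contCocycles φ A H)) = 1
    rw [QuotientGroup.eq_one_iff]
    refine Subgroup.mem_subgroupOf.mpr ((mem_contCoboundaries_iff _).mpr ⟨⟨(a' : G') ^ n, hpow a'⟩, ?_⟩)
    funext h
    have hh : ((f.1 h : A) : G') = φ (h : G) * a' * (φ (h : G))⁻¹ * (a' : G')⁻¹ := by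
      have := congrArg (fun b : A' => (b : G')) (congrFun ha' h)
      simpa [MulAut.conjNormal_apply] using this
    apply Subtype.ext
    have hc : Commute (φ (h : G) * a' * (φ (h : G))⁻¹) ((a' : G')⁻¹) := by
      have h1 : φ (h : G) * a' * (φ (h : G))⁻¹ ∈ A' := by
        simpa [MulAut.conjNormal_apply] using (MulAut.conjNormal (φ (h : G)) a').2
      have h2 : ((a' : G')⁻¹) ∈ A' := A'.inv_mem a'.2
      have := IsMulCommutative.is_comm.comm (⟨_, h1⟩ : A') (⟨_, h2⟩ : A')
      exact congrArg Subtype.val this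
    calc (((f ^ n).1 h : A) : G') = (((f.1 h : A) : G')) ^ n := by
          simp [Pi.pow_apply]
      _ = (φ (h : G) * a' * (φ (h : G))⁻¹ * (a' : G')⁻¹) ^ n := by rw [hh]
      _ = (φ (h : G) * a' * (φ (h : G))⁻¹) ^ n * ((a' : G')⁻¹) ^ n := hc.mul_pow n
      _ = φ (h : G) * (a' : G') ^ n * (φ (h : G))⁻¹ * ((a' : G') ^ n)⁻¹ := by
          rw [inv_pow]
          congr 1
          simp
      _ = _ := by simp [MulAut.conjNormal_apply]

/-- **Torsion is reflected by the change of coefficients** (when `A'`-elements have `n`-th powers in `A`, `n > 0`):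
`coeffChange x` is of finite order iff `x` is. This is the form consumers use («coincides up to torsion» read in
`H¹(−, Δ_Θ)` ⇔ read in `H¹(−, l·Δ_Θ)`). [cite: NeukirchSchmidtWingberg2008, I §2 and II §7] -/
theorem isOfFinOrder_coeffChange_iff {n : ℕ} (hn : 0 < n) (hpow : ∀ a' : A', ((a' : G') ^ n) ∈ A)
    (x : ContH1 φ A H) : IsOfFinOrder (coeffChange φ hAA' H x) ↔ IsOfFinOrder x := by
  constructor
  · intro hx
    obtain ⟨m, hm, hxm⟩ := isOfFinOrder_iff_pow_eq_one.mp hx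
    have h := pow_eq_one_of_coeffChange_eq_one φ hAA' H n hpow (x ^ m) (by rw [map_pow, hxm])
    exact isOfFinOrder_iff_pow_eq_one.mpr ⟨m * n, Nat.mul_pos hm hn, by rw [pow_mul, h]⟩
  · exact fun hx => (coeffChange φ hAA' H).isOfFinOrder hx

/-- Hence: two classes have images differing by torsion iff they differ by torsion.
[cite: NeukirchSchmidtWingberg2008, I §2 and II §7] -/
theorem isOfFinOrder_div_iff_of_coeffChange {n : ℕ} (hn : 0 < n) (hpow : ∀ a' : A', ((a' : G') ^ n) ∈ A)
    (x y : ContH1 φ A H) :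
    IsOfFinOrder (coeffChange φ hAA' H x / coeffChange φ hAA' H y) ↔ IsOfFinOrder (x / y) := by
  rw [← map_div, isOfFinOrder_coeffChange_iff φ hAA' H hn hpow]

end ContH1

end CoeffChange

section CoeffChangeInfl

variable {G₀ G' : Type*} [Group G₀] [TopologicalSpace G₀]
  [Group G'] [TopologicalSpace G'] [IsTopologicalGroup G']
  {A A' : Subgroup G'} [A.Normal] [IsMulCommutative A] [A'.Normal] [IsMulCommutative A']
  (hAA' : A ≤ A') (ψ : G₀ →* G') (hψ : Continuous ψ)

/-- Change of coefficients commutes with INFLATION along a continuous `ψ : G₀ → G'` (`ψ(H₀) ≤ H'`).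
[cite: NeukirchSchmidtWingberg2008, I §2 and II §7] -/
theorem ContH1.infl_coeffChange {H₀ : Subgroup G₀} {H' : Subgroup G'} (h : H₀.map ψ ≤ H')
    (x : ContH1 (MonoidHom.id G') A H') :
    ContH1.infl A' ψ hψ h (ContH1.coeffChange (MonoidHom.id G') hAA' H' x) =
      ContH1.coeffChange ψ hAA' H₀ (ContH1.infl A ψ hψ h x) := by
  induction x using QuotientGroup.induction_on with
  | H f => rfl

end CoeffChangeInfl

section Comap

variable {G₀ G G' : Type*} [Group G₀] [TopologicalSpace G₀] [Group G] [TopologicalSpace G]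
  [Group G'] [TopologicalSpace G'] [IsTopologicalGroup G']
  (φ : G →* G') (A : Subgroup G') [A.Normal] [IsMulCommutative A]
  (ι : G₀ →* G) (hι : Continuous ι)

/-- Pull-back of cocycles along a continuous homomorphism `ι : G₀ → G` from `H ≤ G` to `H₀ ≤ G₀` with
`ι(H₀) ≤ H`, the action on `A` being through `φ ∘ ι` (generalises `inflCocycle`, which is the case `φ = id`; used
for `Π_Ÿ(Π) ⊆ Π^tp_X̲̲ ↪ Π^tp_X`). [cite: NeukirchSchmidtWingberg2008, I §2 and II §7] -/
def ContH1.comapCocycle {H₀ : Subgroup G₀} {H : Subgroup G} (h : H₀.map ι ≤ H) :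
    contCocycles φ A H →* contCocycles (φ.comp ι) A H₀ where
  toFun f := ⟨fun x => f.1 ⟨ι x.1, h ⟨x.1, x.2, rfl⟩⟩,
    f.2.1.comp ((hι.comp continuous_subtype_val).subtype_mk _),
    fun g g' => by
      have := f.2.2 ⟨ι g.1, h ⟨g.1, g.2, rfl⟩⟩ ⟨ι g'.1, h ⟨g'.1, g'.2, rfl⟩⟩
      simpa only [MonoidHom.coe_comp, Function.comp_apply, Subgroup.coe_mul, map_mul,
        MulMemClass.mk_mul_mk] using this⟩
  map_one' := rfl
  map_mul' _ _ := rfl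

/-- **Pull-back** `H¹(H, A) → H¹(H₀, A)` along a continuous `ι : G₀ → G` with `ι(H₀) ≤ H` (functoriality of `H¹`
in the group; `ContH1.infl` is the case `φ = id`). [cite: NeukirchSchmidtWingberg2008, I §2 and II §7] -/
def ContH1.comap {H₀ : Subgroup G₀} {H : Subgroup G} (h : H₀.map ι ≤ H) :
    ContH1 φ A H →* ContH1 (φ.comp ι) A H₀ :=
  QuotientGroup.map _ _ (ContH1.comapCocycle φ A ι hι h) (by
    intro f hf
    obtain ⟨a, ha⟩ := (mem_contCoboundaries_iff _).mp (Subgroup.mem_subgroupOf.mp hf)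
    refine Subgroup.mem_subgroupOf.mpr ((mem_contCoboundaries_iff _).mpr ⟨a, ?_⟩)
    funext x
    have := congrFun ha ⟨ι x.1, h ⟨x.1, x.2, rfl⟩⟩
    simpa [ContH1.comapCocycle] using this)

/-- `ContH1.comap` on the class of a cocycle. [cite: NeukirchSchmidtWingberg2008, I §2 and II §7] -/
theorem ContH1.comap_mk {H₀ : Subgroup G₀} {H : Subgroup G} (h : H₀.map ι ≤ H) (f : H → A)
    (hf : f ∈ contCocycles φ A H) :
    ContH1.comap φ A ι hι h (ContH1.mk f hf) =
      ContH1.mk (fun x => f ⟨ι x.1, h ⟨x.1, x.2, rfl⟩⟩) (ContH1.comapCocycle φ A ι hι h ⟨f, hf⟩).2 := rfl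

/-- Pull-back along `ι` commutes with restriction (`H₀' ≤ H₀` over `H' ≤ H` with `ι(H₀') ≤ H'`).
[cite: NeukirchSchmidtWingberg2008, I §2 and II §7] -/
theorem ContH1.res_comap {H₀ H₀' : Subgroup G₀} {H H' : Subgroup G} (h : H₀.map ι ≤ H) (h' : H₀'.map ι ≤ H')
    (h₀ : H₀' ≤ H₀) (hH : H' ≤ H) (x : ContH1 φ A H) :
    ContH1.res (φ.comp ι) A h₀ (ContH1.comap φ A ι hι h x) =
      ContH1.comap φ A ι hι h' (ContH1.res φ A hH x) := by
  induction x using QuotientGroup.induction_on with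
  | H f => rfl

/-- Pull-back along `ι` intertwines the conjugation actions: conjugating by `ι σ` on `H¹(H, A)` and pulling back
equals pulling back and conjugating by `σ` on `H¹(H₀, A)` (`H`, `H₀` normal). [cite: NeukirchSchmidtWingberg2008, I §2 and II §7] -/
theorem ContH1.comap_conj [IsTopologicalGroup G₀] [IsTopologicalGroup G] {H₀ : Subgroup G₀} {H : Subgroup G}
    [H₀.Normal] [H.Normal] (h : H₀.map ι ≤ H) (σ : G₀) (x : ContH1 φ A H) :
    ContH1.comap φ A ι hι h (ContH1.conj φ A (ι σ) x) =
      ContH1.conj (φ.comp ι) A σ (ContH1.comap φ A ι hι h x) := by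
  induction x using QuotientGroup.induction_on with
  | H f =>
    apply congrArg (QuotientGroup.mk (s := (contCoboundaries (φ.comp ι) A H₀).subgroupOf
      (contCocycles (φ.comp ι) A H₀)))
    apply Subtype.ext
    funext y
    change MulAut.conjNormal (φ (ι σ)) (f.1 (MulAut.conjNormal (ι σ)⁻¹ ⟨ι y.1, _⟩)) =
      MulAut.conjNormal ((φ.comp ι) σ) (f.1 ⟨ι (MulAut.conjNormal σ⁻¹ y).1, _⟩)
    rw [MonoidHom.comp_apply]
    refine congrArg (fun a => MulAut.conjNormal (φ (ι σ)) (f.1 a)) (Subtype.ext ?_)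
    simp [map_mul, map_inv, mul_assoc]

variable {A} {A' : Subgroup G'} [A'.Normal] [IsMulCommutative A'] (hAA' : A ≤ A')

/-- Pull-back along `ι` commutes with change of coefficients. [cite: NeukirchSchmidtWingberg2008, I §2 and II §7] -/
theorem ContH1.comap_coeffChange {H₀ : Subgroup G₀} {H : Subgroup G} (h : H₀.map ι ≤ H) (x : ContH1 φ A H) :
    ContH1.comap φ A' ι hι h (ContH1.coeffChange φ hAA' H x) =
      ContH1.coeffChange (φ.comp ι) hAA' H₀ (ContH1.comap φ A ι hι h x) := by
  induction x using QuotientGroup.induction_on with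
  | H f => rfl

end Comap

end Literature.AnabelianGeometry.EtaleTheta
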